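import Summits.ResolutionOfSingularities.ResolutionOfSingularities.Theorems.MarkedTransferCampaignW46CentreThread
import Summits.ResolutionOfSingularities.ResolutionOfSingularities.Theorems.MarkedTransferCampaignW46MohWindowSurfaceHeavyDichotomy
import Summits.ResolutionOfSingularities.ResolutionOfSingularities.Theorems.MarkedTransferCampaignW46MohWindowSurfaceHeavyInsep
import HarnessLib

/-!
# [OURS · L1 W4.6 rung (iii-2), EVERY `p`] Surface Moh window — THE HEAVY THREAD: an infinite permissible sequence inside the
# coefficient surface-window regime carries a branch of singular points which is blown up AS A HEAVY (non-tame) CENTRE infinitely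
# often (cell res-hironaka, LADDER-RESOLUTION rung L, D-0089; seat res-L1-s46-pv-5 gen 5; host MarkedTransfer,
# `--supports stmt-ResolutionOfSingularities-16155 --as helper`; statement file `…CampaignW46MohWindowSurface.lean`)

HONEST FRAMING. Nothing here is a statement of H. Hironaka's manuscript [Hironaka2017] and nothing here asserts that any
statement of it holds. THEOREM about the OURS regime `CampaignW46.Regime.mohWindowSurface` (o1 §5; every prime `p`, every field `K`
of characteristic `p`). The non-tame all-window rung `MohWindowSurfaceInsepPermissiblyTerminates p K` is OPEN for `p ≥ 3`; the
(H)/(H2) programme of res-D-pv-008 / res-D-pv-050 (formal heavy thread → formal `p`-fold curve through it → the exit door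
`…MohWindowSurfaceFormalExit.lean`) starts from an infinite HEAVY THREAD. This file PROVES that reduction: combine the centre thread
(`PermissibleRun.exists_centre_thread`, `…CentreThread.lean`: a branch `b_k ∈ Sing(E_k)`, `π_k b_{k+1} = b_k`, hit by the centres
infinitely often) with the residual order along the branch — constant while the branch is not blown up
(`residualOrder_eq_of_not_over_centre`), strictly dropping when it is blown up at a TAME point (`residualOrder_lt_of_over_tame_centre`,
`…HeavyDichotomy.lean`) — so the branch must be blown up at NON-TAME (heavy) points infinitely often. AI-written; AI review is weaker
than expert review. No `sorry`; axioms standard.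

WHAT IS PROVED.
* `PermissibleRun.exists_heavy_thread` — **HEAVY THREAD**: for an infinite §2.1-permissible sequence inside `Regime.mohWindowSurface`
  there is a branch of singular points `b` (`b_k ∈ Sing(E_k)`, `π_k b_{k+1} = b_k`) such that for infinitely many `k` the centre is
  `{b_k}` AND the window ideal at `b_k` is NOT tame (`¬ MohWindowSurfaceTameAt`). So `MohWindowSurfaceInsepPermissiblyTerminates p K`
  (⇔ the coefficient regime, res-D-pv-050) is EQUIVALENT to the non-existence of such heavy threads.
[ZariskiSamuel1960] [Matsumura1987] [HauserWagner2014] [CossartPiltant2008]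
-/

noncomputable section

set_option linter.dupNamespace false -- mandated namespace of this single-conjunct summit

open CategoryTheory AlgebraicGeometry TopologicalSpace IsLocalRing

namespace Summit.ResolutionOfSingularities.ResolutionOfSingularities.Theorems

namespace CampaignW46

open Literature.AlgebraicGeometry.Resolution
open Literature.AlgebraicGeometry.Hironaka2017.S02Preliminaries
open Literature.AlgebraicGeometry.Hironaka2017.Datum
open Scheme.IdealSheafData

universe u

variable {p : ℕ} [Fact p.Prime] {K : Type u} [Field K] [CharP K p]

/-- **[OURS · L1 W4.6 rung (iii-2), every `p`] THE HEAVY THREAD.** Let `r` be an infinite §2.1-permissible sequence all of whose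
stages lie in `Regime.mohWindowSurface`. Then there is a branch of singular points `b_k ∈ Sing(E_k)`, `π_k(b_{k+1}) = b_k`, such that
for every `k₀` there is `k ≥ k₀` at which `b_k` IS the centre and the window ideal `J_{b_k}` is NOT tame (a heavy point: in every
coefficient presentation the residue form has a `κ`-rational root of multiplicity `≥ p` in one of the two charts). NOT a statement of
the manuscript. [folklore] -/
theorem PermissibleRun.exists_heavy_thread (r : PermissibleRun p K) (hr : ∀ k, Regime.mohWindowSurface (r.A k) (r.E k)) :
    ∃ b : ∀ k, (r.A k).Z, (∀ k, b k ∈ (r.E k).sing) ∧ (∀ k, (r.π k).base (b (k + 1)) = b k) ∧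
      ∀ k₀, ∃ k, k₀ ≤ k ∧ b k ∈ (r.D k : Set (r.A k).Z) ∧
        ¬ MohWindowSurfaceTameAt (r.E k).b ((r.A k).Z.presheaf.stalk (b k)) (stalkIdeal (r.E k).J (b k)) := by
  classical
  obtain ⟨b, hbS, hbπ, hhit⟩ := r.exists_centre_thread (fun k => (hr k).2.1) (fun k => (hr k).2.2.1)
  refine ⟨b, hbS, hbπ, fun k₀ => ?_⟩
  by_contra hno
  push Not at hno
  -- the residual order along the branch
  let v : ℕ → ℕ := fun k => (residualOrder (r.E k).b ((r.A k).Z.presheaf.stalk (b k)) (stalkIdeal (r.E k).J (b k))).toNat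
  -- one step, stated for an arbitrary next stage `E₁ = transform` (dependent rewriting along `E_succ`)
  have key : ∀ k (E₁ : IdealExponent (r.A (k + 1)).Z) (heq : E₁ = (r.E k).transform (r.π k) (r.D k))
      (h₁ : Regime.mohWindowSurface (r.A (k + 1)) E₁) (hb₁ : b (k + 1) ∈ E₁.sing),
      ((b k ∉ (r.D k : Set (r.A k).Z)) →
        (residualOrder E₁.b ((r.A (k + 1)).Z.presheaf.stalk (b (k + 1))) (stalkIdeal E₁.J (b (k + 1)))).toNat = v k) ∧
      ((b k ∈ (r.D k : Set (r.A k).Z)) →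
        (∀ ξ ∈ (r.D k : Set (r.A k).Z), MohWindowSurfaceTameAt (r.E k).b ((r.A k).Z.presheaf.stalk ξ) (stalkIdeal (r.E k).J ξ)) →
        (residualOrder E₁.b ((r.A (k + 1)).Z.presheaf.stalk (b (k + 1))) (stalkIdeal E₁.J (b (k + 1)))).toNat < v k) := by
    intro k E₁ heq h₁ hb₁
    subst heq
    refine ⟨fun hnot => ?_, fun hin htame => ?_⟩
    · have hover : (r.π k).base (b (k + 1)) ∉ (r.D k : Set (r.A k).Z) := by rw [hbπ k]; exact hnot
      have := congrArg ENat.toNat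
        (MohWindowSurfacePermissible.residualOrder_eq_of_not_over_centre (E := r.E k) (r.π k) (r.blowup k) hover)
      rwa [hbπ k] at this
    · have hover : (r.π k).base (b (k + 1)) ∈ (r.D k : Set (r.A k).Z) := by rw [hbπ k]; exact hin
      have := residualOrder_lt_of_over_tame_centre (r.π k) (r.blowup k) (r.permissible k) (hr k) h₁ htame hb₁ hover
      rwa [hbπ k] at this
  -- along the branch: the value never increases from `k₀` on, and drops at every hit
  have hcentre : ∀ k, b k ∈ (r.D k : Set (r.A k).Z) → ∀ ξ ∈ (r.D k : Set (r.A k).Z), ξ = b k := by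
    intro k hbk ξ hξ
    obtain ⟨ξ₀, -, -, hD⟩ := IsPermissibleCentre.exists_eq_singleton_of_isolatedSing (r.permissible k) ⟨(hr k).2.1, (hr k).2.2.1⟩
    rw [hD] at hbk hξ
    rw [Set.mem_singleton_iff.mp hbk, Set.mem_singleton_iff.mp hξ]
  have hmono : ∀ k, k₀ ≤ k → v (k + 1) ≤ v k := by
    intro k hk
    obtain ⟨htr, hdr⟩ := key k (r.E (k + 1)) (r.E_succ k) (hr (k + 1)) (hbS (k + 1))
    by_cases hbk : b k ∈ (r.D k : Set (r.A k).Z)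
    · have htame : ∀ ξ ∈ (r.D k : Set (r.A k).Z),
          MohWindowSurfaceTameAt (r.E k).b ((r.A k).Z.presheaf.stalk ξ) (stalkIdeal (r.E k).J ξ) := by
        intro ξ hξ; rw [hcentre k hbk ξ hξ]; exact hno k hk hbk
      exact (hdr hbk htame).le
    · exact (htr hbk).le
  have hdrop : ∀ k, k₀ ≤ k → b k ∈ (r.D k : Set (r.A k).Z) → v (k + 1) < v k := by
    intro k hk hbk
    obtain ⟨-, hdr⟩ := key k (r.E (k + 1)) (r.E_succ k) (hr (k + 1)) (hbS (k + 1))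
    have htame : ∀ ξ ∈ (r.D k : Set (r.A k).Z),
        MohWindowSurfaceTameAt (r.E k).b ((r.A k).Z.presheaf.stalk ξ) (stalkIdeal (r.E k).J ξ) := by
      intro ξ hξ; rw [hcentre k hbk ξ hξ]; exact hno k hk hbk
    exact hdr hbk htame
  have hmono' : ∀ k, k₀ ≤ k → ∀ j, v (k + j) ≤ v k := by
    intro k hk j
    induction j with
    | zero => exact le_rfl
    | succ j ih => exact (hmono (k + j) (by omega)).trans ih
  -- infinitely many drops of a natural number: contradiction
  have hacc : ∀ n, ∃ k, k₀ ≤ k ∧ v k + n ≤ v k₀ := by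
    intro n
    induction n with
    | zero => exact ⟨k₀, le_rfl, by omega⟩
    | succ n ih =>
      obtain ⟨k, hk, hvk⟩ := ih
      obtain ⟨k', hkk', hbk'⟩ := hhit k
      have h1 : v k' ≤ v k := by
        have := hmono' k hk (k' - k)
        rwa [Nat.add_sub_cancel' hkk'] at this
      have h2 := hdrop k' (hk.trans hkk') hbk'
      exact ⟨k' + 1, by omega, by omega⟩
  obtain ⟨k, -, hk⟩ := hacc (v k₀ + 1)
  omega

/-- **Corollary (the open rung as a thread statement).** If NO infinite §2.1-permissible sequence inside `Regime.mohWindowSurface`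
admits a branch of singular points blown up at heavy points infinitely often, then the non-tame all-window rung
`MohWindowSurfaceInsepPermissiblyTerminates p K` holds. NOT a statement of the manuscript. [folklore] -/
theorem mohWindowSurfaceInsepPermissiblyTerminates_of_no_heavy_thread
    (h : ∀ r : PermissibleRun p K, (∀ k, Regime.mohWindowSurface (r.A k) (r.E k)) →
      ∀ b : ∀ k, (r.A k).Z, (∀ k, b k ∈ (r.E k).sing) → (∀ k, (r.π k).base (b (k + 1)) = b k) →
        ∃ k₀, ∀ k, k₀ ≤ k → b k ∈ (r.D k : Set (r.A k).Z) →
          MohWindowSurfaceTameAt (r.E k).b ((r.A k).Z.presheaf.stalk (b k)) (stalkIdeal (r.E k).J (b k))) :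
    MohWindowSurfaceInsepPermissiblyTerminates p K := by
  refine permissiblyTerminates_antitone (fun A E hAE => (regimeMohWindowSurfaceInsep_iff_mohWindowSurface A E).mp hAE) ?_
  intro r hr
  obtain ⟨b, hbS, hbπ, hheavy⟩ := r.exists_heavy_thread hr
  obtain ⟨k₀, hk₀⟩ := h r hr b hbS hbπ
  obtain ⟨k, hk, hbk, hnt⟩ := hheavy k₀
  exact hnt (hk₀ k hk hbk)

end CampaignW46

end Summit.ResolutionOfSingularities.ResolutionOfSingularities.Theorems

end
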